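import Summits.AtomisticToContinuum.FouriersLaw.Theorems.EmbeddedDrudeMourreMourreDissolutionFreeLevelShift
import HarnessLib

/-!
# The force window, part I: continuity at the two-phonon threshold for a slab-dominated weight
(stub `stub_forceWindow` (KT) of line `gram-pencil-harmonic-chaos`, crux `EmbeddedDrudeMourre.DrudeDissolution`,
item stmt-AtomisticToContinuum-12593; `--supports` file, closes nothing)

WHAT. The continuity assembly of the sibling crux stmt-AtomisticToContinuum-12594 (line
`swap-odd-threshold-rigidity`, namespace `…Theorems.MourreDissolution`) re-run for an ARBITRARY weight:
for `ω₂ > 0` and every continuous, coordinatewise `2π`-periodic weight `W ≥ 0` on `ℝ³` dominated by the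
two exchange slabs, `W(p) ≤ C_W sin²((k₃−k₁)/2) sin²((k₂−k₃)/2)` at `p = (k₁,(k₃,k₂))`, the pushforward
`Ω_*(W dk)` of the weighted cell `(−π,π]³` under the pair resonance function
`Ω(p) = resonanceFn ω₂ k₁ k₂ k₃ = ω₁ + ω₂ − ω₃ − ω(k₁+k₂−k₃)` has a continuous non-negative density on
the window `(−δ, δ)`, `δ = √(ω₂+4) − √ω₂` (`forceWindow_thresholdContinuous`). This is the hypothesis-free
form of `MourreDissolution.thresholdDensityContinuous` (there `W = Φ²(∏ω)⁻²[f]²`), consumed by the pair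
sector of the force kernel of stub KT, whose weight `|S₂₂P|²` is slab-dominated but not of that form.

HOW. NC for `W` (`forceWindow_slabNC`): on the `(k₃−k₁)`-slab this is the landed core estimate
`MourreDissolution.slabNC_core` (stated for any measurable weight under the slab domination), with the
radii, floors and gaps of `…VelocityShape` chosen word for word as in
`MourreDissolution.stub_slabNonconcentration`; the `(k₂−k₃)`-slab is moved onto the `(k₃−k₁)`-slab by
the volume-preserving swap `(k₁,(k₃,k₂)) ↦ (k₂,(k₃,k₁))`, which fixes `Ω` and the domination
(`forceWindow_slab_swap`, applied to the weight `W ∘ swap`). CONT: the abstract assembly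
`MourreDissolution.contAsm_assembly` fed with GLUE `stub_densityApproximation`, REG
`stub_regularValueDensity stub_monotoneFibreDensity`, PER `stub_periodisation`, the regular-value
check `contAsm_crit` and this NC. Measure plumbing over Mathlib; no cited facts.
-/

noncomputable section

namespace Summit.AtomisticToContinuum.FouriersLaw.Theorems.DrudeDissolution.GramPencilHarmonicChaos

open Real Set MeasureTheory Filter Topology
open scoped ENNReal
open Literature.MathematicalPhysics.KineticTheory.PhononBoltzmann
open Summit.AtomisticToContinuum.FouriersLaw.Theorems.MourreDissolution

/-! ### The `k₁ ↔ k₂` symmetry of the two exchange slabs, general weight -/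

/-- **Symmetry of the two slabs (general weight).** The sublevel integral of a weight `W` over the
slab `{|sin((k₂−k₃)/2)| < η}` of the cell equals the one of `W ∘ swap` over `{|sin((k₃−k₁)/2)| < η}`,
`swap (k₁,(k₃,k₂)) = (k₂,(k₃,k₁))` (`Ω` is symmetric under `k₁ ↔ k₂`, the swap preserves volume and
the cell). [folklore] -/
theorem forceWindow_slab_swap (ω₂ : ℝ) (W : ℝ × ℝ × ℝ → ℝ≥0∞) (η E r : ℝ) :
    ∫⁻ p in (Ioc (-π) π ×ˢ (Ioc (-π) π ×ˢ Ioc (-π) π)) ∩ {p | |Real.sin ((p.2.2 - p.2.1) / 2)| < η},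
        (Ioo (E - r) (E + r)).indicator 1 (resonanceFn ω₂ p.1 p.2.2 p.2.1) * W p =
      ∫⁻ p in (Ioc (-π) π ×ˢ (Ioc (-π) π ×ˢ Ioc (-π) π)) ∩ {p | |Real.sin ((p.2.1 - p.1) / 2)| < η},
        (Ioo (E - r) (E + r)).indicator 1 (resonanceFn ω₂ p.1 p.2.2 p.2.1) * W (p.2.2, (p.2.1, p.1)) := by
  set I : Set ℝ := Ioc (-π) π with hI
  set σ : ℝ × ℝ × ℝ → ℝ × ℝ × ℝ := fun p => (p.2.2, (p.2.1, p.1)) with hσ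
  set G : ℝ × ℝ × ℝ → ℝ≥0∞ := fun p =>
    (Ioo (E - r) (E + r)).indicator 1 (resonanceFn ω₂ p.1 p.2.2 p.2.1) * W (σ p) with hG
  have hset : (I ×ˢ (I ×ˢ I)) ∩ {p | |Real.sin ((p.2.2 - p.2.1) / 2)| < η} =
      σ ⁻¹' ((I ×ˢ (I ×ˢ I)) ∩ {p | |Real.sin ((p.2.1 - p.1) / 2)| < η}) := by
    ext p
    simp only [hσ, mem_inter_iff, mem_prod, mem_setOf_eq, mem_preimage]
    rw [show (p.2.1 - p.2.2) / 2 = -((p.2.2 - p.2.1) / 2) by ring, Real.sin_neg, abs_neg]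
    tauto
  have hGσ : ∀ p, G (σ p) = (Ioo (E - r) (E + r)).indicator 1 (resonanceFn ω₂ p.1 p.2.2 p.2.1) * W p := by
    intro p
    simp only [hG, hσ]
    rw [slabFibre_resonanceFn_swap12]
  have hσm : Measurable σ := measurable_snd.snd.prodMk (measurable_snd.fst.prodMk measurable_fst)
  let e : (ℝ × ℝ × ℝ) ≃ᵐ (ℝ × ℝ × ℝ) :=
    { toFun := σ, invFun := σ, left_inv := fun _ => rfl, right_inv := fun _ => rfl,
      measurable_toFun := hσm, measurable_invFun := hσm }
  have hemb : MeasurableEmbedding σ := e.measurableEmbedding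
  calc ∫⁻ p in (I ×ˢ (I ×ˢ I)) ∩ {p | |Real.sin ((p.2.2 - p.2.1) / 2)| < η},
        (Ioo (E - r) (E + r)).indicator 1 (resonanceFn ω₂ p.1 p.2.2 p.2.1) * W p
      = ∫⁻ p in σ ⁻¹' ((I ×ˢ (I ×ˢ I)) ∩ {p | |Real.sin ((p.2.1 - p.1) / 2)| < η}), G (σ p) := by
        rw [hset]; exact lintegral_congr fun p => (hGσ p).symm
    _ = ∫⁻ p in (I ×ˢ (I ×ˢ I)) ∩ {p | |Real.sin ((p.2.1 - p.1) / 2)| < η}, G p :=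
        slabNC_measurePreserving_swap13.setLIntegral_comp_preimage_emb hemb G _

/-- The slab domination `W ≤ C_W sin²((k₃−k₁)/2) sin²((k₂−k₃)/2)` is symmetric under the swap
`(k₁,(k₃,k₂)) ↦ (k₂,(k₃,k₁))`. [folklore] -/
theorem forceWindow_domination_swap {Cw : ℝ} {W : ℝ × ℝ × ℝ → ℝ}
    (hW : ∀ p : ℝ × ℝ × ℝ, W p ≤ Cw * Real.sin ((p.2.1 - p.1) / 2) ^ 2 * Real.sin ((p.2.2 - p.2.1) / 2) ^ 2)
    (p : ℝ × ℝ × ℝ) :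
    W (p.2.2, (p.2.1, p.1)) ≤ Cw * Real.sin ((p.2.1 - p.1) / 2) ^ 2 * Real.sin ((p.2.2 - p.2.1) / 2) ^ 2 := by
  refine (hW _).trans_eq ?_
  dsimp only
  rw [show (p.2.1 - p.2.2) / 2 = -((p.2.2 - p.2.1) / 2) by ring,
    show (p.1 - p.2.1) / 2 = -((p.2.1 - p.1) / 2) by ring, Real.sin_neg, Real.sin_neg, neg_sq, neg_sq]
  ring

/-! ### Slab non-concentration for a slab-dominated weight -/

/-- **NC for a general slab-dominated weight.** For `ω₂ > 0`, a measurable weight `W` on `ℝ³` with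
`W(p) ≤ C_W sin²((k₃−k₁)/2) sin²((k₂−k₃)/2)` (`p = (k₁,(k₃,k₂))`, `C_W ≥ 0`) and every `ε > 0` there
is `η > 0` such that for all `E` and `r > 0` the `W`-weighted Lebesgue measure of `{|Ω − E| < r}` inside
the cell part of the two exchange slabs `{|sin((k₃−k₁)/2)| < η} ∪ {|sin((k₂−k₃)/2)| < η}` is `≤ ε·r`
(`Ω = resonanceFn ω₂ k₁ k₂ k₃`). The `(k₃−k₁)`-slab is `MourreDissolution.slabNC_core` with the
geometry of `…VelocityShape` (as in `MourreDissolution.stub_slabNonconcentration`); the other slab is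
its image under the volume-preserving swap `k₁ ↔ k₂` (`forceWindow_slab_swap`). [folklore] -/
theorem forceWindow_slabNC {ω₂ : ℝ} (hω : 0 < ω₂) {Cw : ℝ} (hCw : 0 ≤ Cw) {W : ℝ × ℝ × ℝ → ℝ}
    (hWm : Measurable W)
    (hW : ∀ p : ℝ × ℝ × ℝ, W p ≤ Cw * Real.sin ((p.2.1 - p.1) / 2) ^ 2 * Real.sin ((p.2.2 - p.2.1) / 2) ^ 2) :
    ∀ ε : ℝ, 0 < ε → ∃ η : ℝ, 0 < η ∧ ∀ E r : ℝ, 0 < r →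
      ∫⁻ p in (Set.Ioc (-Real.pi) Real.pi ×ˢ (Set.Ioc (-Real.pi) Real.pi ×ˢ Set.Ioc (-Real.pi) Real.pi)) ∩
          {p : ℝ × ℝ × ℝ | |Real.sin ((p.2.1 - p.1) / 2)| < η ∨ |Real.sin ((p.2.2 - p.2.1) / 2)| < η},
        (Set.Ioo (E - r) (E + r)).indicator (fun _ => (1 : ENNReal)) (resonanceFn ω₂ p.1 p.2.2 p.2.1) *
          ENNReal.ofReal (W p) ≤ ENNReal.ofReal (ε * r) := by
  intro ε hε
  have hpi := Real.pi_pos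
  have hpi3 := Real.pi_gt_three
  -- geometry of the group velocity (depends on `ω₂` only), exactly as in `stub_slabNonconcentration`
  have hκ := velShape_kappaStar_mem hω
  obtain ⟨R, hR_def⟩ : ∃ R : ℝ, R = min (kappaStar ω₂) (π - kappaStar ω₂) / 2 := ⟨_, rfl⟩
  have hmin0 : 0 < min (kappaStar ω₂) (π - kappaStar ω₂) := lt_min hκ.1 (by linarith [hκ.2])
  have hR0 : 0 < R := by rw [hR_def]; positivity
  have hRκ : R ≤ kappaStar ω₂ / 2 := by
    have := min_le_left (kappaStar ω₂) (π - kappaStar ω₂); rw [hR_def]; linarith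
  have hRπ : R ≤ (π - kappaStar ω₂) / 2 := by
    have := min_le_right (kappaStar ω₂) (π - kappaStar ω₂); rw [hR_def]; linarith
  -- junction floors, restricted to `[±κ − R, ±κ + R]`
  obtain ⟨cJ₁, hcJ₁, hJ₁⟩ := velShape_deriv2_floor_max hω
  obtain ⟨cJ₂, hcJ₂, hJ₂⟩ := velShape_deriv2_floor_min hω
  have hJ₁' : ∀ t ∈ Icc (kappaStar ω₂ - R) (kappaStar ω₂ + R),
      deriv (deriv (groupVelocity ω₂)) t ≤ -min cJ₁ cJ₂ := fun t ht => by
    have := hJ₁ t ⟨by linarith [ht.1], by linarith [ht.2]⟩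
    have := min_le_left cJ₁ cJ₂; linarith
  have hJ₂' : ∀ t ∈ Icc (-kappaStar ω₂ - R) (-kappaStar ω₂ + R),
      min cJ₁ cJ₂ ≤ deriv (deriv (groupVelocity ω₂)) t := fun t ht => by
    have := hJ₂ t ⟨by linarith [ht.1], by linarith [ht.2]⟩
    have := min_le_right cJ₁ cJ₂; linarith
  -- velocity gaps at `±κ` with `d₂ = (R/4)/2`
  have hρ₂0 : 0 < R / 4 := by positivity
  obtain ⟨d₁p, hd₁p, γp, hγp, hgapp⟩ := velShape_gap_max hω (half_pos hρ₂0)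
  obtain ⟨d₁m, hd₁m, γm, hγm, hgapm⟩ := velShape_gap_min hω (half_pos hρ₂0)
  have hgapp' : ∀ u t : ℝ, |u - kappaStar ω₂| ≤ d₁p → t ∈ Icc (-π - 1) (π + 1) →
      R / 4 / 2 ≤ |t - kappaStar ω₂| → groupVelocity ω₂ t + min γp γm ≤ groupVelocity ω₂ u :=
    fun u t h1 h2 h3 => by have := hgapp u t h1 h2 h3; have := min_le_left γp γm; linarith
  have hgapm' : ∀ u t : ℝ, |u + kappaStar ω₂| ≤ d₁m → t ∈ Icc (-π - 1) (π + 1) →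
      R / 4 / 2 ≤ |t + kappaStar ω₂| → groupVelocity ω₂ u + min γp γm ≤ groupVelocity ω₂ t :=
    fun u t h1 h2 h3 => by have := hgapm u t h1 h2 h3; have := min_le_right γp γm; linarith
  -- the near radius `ρ₁`
  obtain ⟨ρ₁, hρ₁_def⟩ : ∃ ρ₁ : ℝ, ρ₁ = min (min d₁p d₁m) (R / 4) / 2 := ⟨_, rfl⟩
  have hρ₁0 : 0 < ρ₁ := by
    have := lt_min (lt_min hd₁p hd₁m) hρ₂0; rw [hρ₁_def]; positivity
  have hρ₁p : ρ₁ ≤ d₁p / 2 := by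
    have := (min_le_left (min d₁p d₁m) (R / 4)).trans (min_le_left _ _); rw [hρ₁_def]; linarith
  have hρ₁m : ρ₁ ≤ d₁m / 2 := by
    have := (min_le_left (min d₁p d₁m) (R / 4)).trans (min_le_right _ _); rw [hρ₁_def]; linarith
  have hρ₁ρ : ρ₁ ≤ R / 4 / 2 := by
    have := min_le_right (min d₁p d₁m) (R / 4); rw [hρ₁_def]; linarith
  -- floors of `|v'|` with `d = ρ₁/2`
  obtain ⟨c₁, hc₁, hinc⟩ := velShape_deriv_floor_inc hω (half_pos hρ₁0)
  obtain ⟨c₂, hc₂, hdec⟩ := velShape_deriv_floor_dec hω (half_pos hρ₁0)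
  have hinc' : ∀ t ∈ Icc (-kappaStar ω₂ + ρ₁ / 2) (kappaStar ω₂ - ρ₁ / 2),
      min c₁ c₂ ≤ deriv (groupVelocity ω₂) t := fun t ht => (min_le_left c₁ c₂).trans (hinc t ht)
  have hdec' : ∀ t ∈ Icc (kappaStar ω₂ + ρ₁ / 2) (2 * π - kappaStar ω₂ - ρ₁ / 2),
      deriv (groupVelocity ω₂) t ≤ -min c₁ c₂ := fun t ht => by
    have := hdec t ht; have := min_le_right c₁ c₂; linarith
  have hc : 0 < min c₁ c₂ := lt_min hc₁ hc₂
  have hγ : 0 < min γp γm := lt_min hγp hγm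
  have hcJ : 0 < min cJ₁ cJ₂ := lt_min hcJ₁ hcJ₂
  -- the coefficient per unit `η·r` and the choice of `η`
  obtain ⟨M, hM_def⟩ : ∃ M : ℝ, M = (2 * π) ^ 2 * 3 * Cw / min c₁ c₂ +
      2 * ((2 * π) ^ 2 * 3 * Cw * 2 / min γp γm) +
      2 * (Cw * π * (ρ₁ + R / 4) / (8 * min cJ₁ cJ₂) * (2 * (ρ₁ + R / 4)) * (2 * π)) := ⟨_, rfl⟩
  have hM0 : 0 ≤ M := by rw [hM_def]; positivity
  obtain ⟨η, hη_def⟩ : ∃ η : ℝ, η = min (min (1 / 4) (ρ₁ / (2 * π))) (ε / (2 * M + 1)) := ⟨_, rfl⟩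
  have hη0 : 0 < η := by rw [hη_def]; positivity
  have hη4 : η ≤ 1 / 4 := by rw [hη_def]; exact (min_le_left _ _).trans (min_le_left _ _)
  have hηρ : π * η ≤ ρ₁ / 2 := by
    have : η ≤ ρ₁ / (2 * π) := by rw [hη_def]; exact (min_le_left _ _).trans (min_le_right _ _)
    rw [le_div_iff₀ (by positivity)] at this; linarith
  have hηε : η ≤ ε / (2 * M + 1) := by rw [hη_def]; exact min_le_right _ _
  refine ⟨η, hη0, fun E r hr => ?_⟩
  -- the weight bounds, for `W` and for `W ∘ swap`
  have hw₃ : ∀ p : ℝ × ℝ × ℝ, ENNReal.ofReal (W p) ≤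
      ENNReal.ofReal (Cw * Real.sin ((p.2.1 - p.1) / 2) ^ 2 * Real.sin ((p.2.2 - p.2.1) / 2) ^ 2) :=
    fun p => ENNReal.ofReal_le_ofReal (hW p)
  have hw₃' : ∀ p : ℝ × ℝ × ℝ, ENNReal.ofReal (W (p.2.2, (p.2.1, p.1))) ≤
      ENNReal.ofReal (Cw * Real.sin ((p.2.1 - p.1) / 2) ^ 2 * Real.sin ((p.2.2 - p.2.1) / 2) ^ 2) :=
    fun p => ENNReal.ofReal_le_ofReal (forceWindow_domination_swap hW p)
  have hWm₀ : Measurable fun p : ℝ × ℝ × ℝ => ENNReal.ofReal (W p) := hWm.ennreal_ofReal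
  have hWm' : Measurable fun p : ℝ × ℝ × ℝ => ENNReal.ofReal (W (p.2.2, (p.2.1, p.1))) :=
    (hWm.comp (measurable_snd.snd.prodMk (measurable_snd.fst.prodMk measurable_fst))).ennreal_ofReal
  -- the `(k₃ − k₁)`-slab, for both weights
  have hcore := slabNC_core hω hc hγ hcJ hCw hη0 hη4 hηρ hρ₁0 hρ₂0 hρ₁p hρ₁m hρ₁ρ rfl hRκ hinc' hdec'
    hgapp' hgapm' hJ₁' hJ₂' hWm₀ hw₃ hr.le E
  have hcore' := slabNC_core hω hc hγ hcJ hCw hη0 hη4 hηρ hρ₁0 hρ₂0 hρ₁p hρ₁m hρ₁ρ rfl hRκ hinc' hdec'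
    hgapp' hgapm' hJ₁' hJ₂' hWm' hw₃' hr.le E
  -- real-number bookkeeping
  have hηsq : η ≤ 1 := by linarith
  have hb1 := slabNC_b1 (Cw := Cw) (η := η) (r := r) hc
  have hb2 := slabNC_b2 (Cw := Cw) hγ hCw hη0.le hηsq hr.le
  have hb3 := slabNC_b3 (Cw := Cw) (ρ₁ := ρ₁) (ρ₂ := R / 4) hcJ hCw (by positivity) hη0.le hηsq hr.le
  have hsumM : (2 * π) ^ 2 * (3 * (Cw * r * η / min c₁ c₂)) +
        (2 * π) ^ 2 * (3 * (Cw * η ^ 2 * (2 * r / min γp γm))) +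
        Cw * (π * η) * (ρ₁ + R / 4) * r / (8 * min cJ₁ cJ₂) * (2 * (ρ₁ + R / 4) * (2 * (π * η))) +
        (2 * π) ^ 2 * (3 * (Cw * η ^ 2 * (2 * r / min γp γm))) +
        Cw * (π * η) * (ρ₁ + R / 4) * r / (8 * min cJ₁ cJ₂) * (2 * (ρ₁ + R / 4) * (2 * (π * η))) ≤
      M * η * r :=
    calc _ ≤ (2 * π) ^ 2 * 3 * Cw / min c₁ c₂ * η * r + (2 * π) ^ 2 * 3 * Cw * 2 / min γp γm * η * r +
          Cw * π * (ρ₁ + R / 4) / (8 * min cJ₁ cJ₂) * (2 * (ρ₁ + R / 4)) * (2 * π) * η * r +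
          (2 * π) ^ 2 * 3 * Cw * 2 / min γp γm * η * r +
          Cw * π * (ρ₁ + R / 4) / (8 * min cJ₁ cJ₂) * (2 * (ρ₁ + R / 4)) * (2 * π) * η * r :=
          add_le_add (add_le_add (add_le_add (add_le_add hb1.le hb2) hb3) hb2) hb3
      _ = M * η * r := by rw [hM_def]; ring
  have hD := hcore.trans (ENNReal.ofReal_le_ofReal hsumM)
  have hD' := hcore'.trans (ENNReal.ofReal_le_ofReal hsumM)
  have h2M : M * η * r + M * η * r ≤ ε * r := by
    have h1 : η * (2 * M + 1) ≤ ε := by rwa [le_div_iff₀ (by positivity)] at hηε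
    nlinarith
  -- both slabs
  have hsym := forceWindow_slab_swap ω₂ (fun p => ENNReal.ofReal (W p)) η E r
  rw [show (fun _ : ℝ => (1 : ENNReal)) = (1 : ℝ → ℝ≥0∞) from rfl, setOf_or, inter_union_distrib_left]
  refine (lintegral_union_le _ _ _).trans ?_
  rw [hsym]
  calc _ ≤ ENNReal.ofReal (M * η * r) + ENNReal.ofReal (M * η * r) := add_le_add hD hD'
    _ = ENNReal.ofReal (M * η * r + M * η * r) := (ENNReal.ofReal_add (by positivity) (by positivity)).symm
    _ ≤ ENNReal.ofReal (ε * r) := ENNReal.ofReal_le_ofReal h2M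

/-! ### Continuity at the threshold for a slab-dominated weight -/

/-- **Generalised threshold continuity (W2 of stub KT).** For `ω₂ > 0` and ANY continuous,
coordinatewise `2π`-periodic weight `W ≥ 0` on `ℝ³` dominated by the exchange slabs,
`W(p) ≤ C_W sin²((k₃−k₁)/2) sin²((k₂−k₃)/2)` at `p = (k₁,(k₃,k₂))`, the pushforward of `W dk` (Lebesgue
measure of the cell `(−π,π]³`) under the pair resonance function `p ↦ Ω(k₁,k₂,k₃)` has a continuous
non-negative density `ρ` on a window `(−δ, δ)`, `δ > 0` (in fact `δ = √(ω₂+4) − √ω₂`). Assembly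
`MourreDissolution.contAsm_assembly` with GLUE, PER, REG, the regular-value check `contAsm_crit` (all
landed on the sibling crux) and NC `forceWindow_slabNC`. [folklore] -/
theorem forceWindow_thresholdContinuous {ω₂ : ℝ} (hω : 0 < ω₂) {Cw : ℝ} (hCw : 0 ≤ Cw)
    {W : ℝ × ℝ × ℝ → ℝ} (hWc : Continuous W) (hW0 : ∀ p, 0 ≤ W p)
    (hW₁ : ∀ p : ℝ × ℝ × ℝ, W (p.1 + 2 * Real.pi, p.2) = W p)
    (hW₂ : ∀ p : ℝ × ℝ × ℝ, W (p.1, p.2.1 + 2 * Real.pi, p.2.2) = W p)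
    (hW₃ : ∀ p : ℝ × ℝ × ℝ, W (p.1, p.2.1, p.2.2 + 2 * Real.pi) = W p)
    (hW : ∀ p : ℝ × ℝ × ℝ, W p ≤ Cw * Real.sin ((p.2.1 - p.1) / 2) ^ 2 * Real.sin ((p.2.2 - p.2.1) / 2) ^ 2) :
    ∃ δ : ℝ, 0 < δ ∧ ∃ ρ : ℝ → ℝ, ContinuousOn ρ (Set.Ioo (-δ) δ) ∧ (∀ x ∈ Set.Ioo (-δ) δ, 0 ≤ ρ x) ∧
      (MeasureTheory.Measure.map (fun p : ℝ × ℝ × ℝ => resonanceFn ω₂ p.1 p.2.2 p.2.1)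
          (((volume.restrict (Set.Ioc (-Real.pi) Real.pi)).prod
              ((volume.restrict (Set.Ioc (-Real.pi) Real.pi)).prod
                (volume.restrict (Set.Ioc (-Real.pi) Real.pi)))).withDensity
            (fun p : ℝ × ℝ × ℝ => ENNReal.ofReal (W p)))).restrict (Set.Ioo (-δ) δ) =
        (volume.restrict (Set.Ioo (-δ) δ)).withDensity (fun x => ENNReal.ofReal (ρ x)) :=
  ⟨_, contAsm_delta_pos hω,
    contAsm_assembly stub_densityApproximation (stub_regularValueDensity stub_monotoneFibreDensity)
      contAsm_psi_continuous contAsm_psi_nonneg contAsm_psi_hasCompactSupport stub_periodisation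
      (contAsm_delta_pos hω) hWc hW0 hW₁ hW₂ hW₃ (contAsm_contDiff_resonanceFn hω)
      (fun _ => (contAsm_resonanceFn_periodic ω₂ _ _ _).1)
      (fun _ => (contAsm_resonanceFn_periodic ω₂ _ _ _).2.2)
      (fun _ => (contAsm_resonanceFn_periodic ω₂ _ _ _).2.1) (contAsm_crit ω₂ hω)
      (forceWindow_slabNC hω hCw hWc.measurable hW)⟩


/-- **Registered helper (stub KT, part W2): generalised threshold continuity.** For `ω₂ > 0` and every
continuous, coordinatewise `2π`-periodic, slab-dominated weight `W ≥ 0` on `ℝ³`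
(`W(p) ≤ C_W sin²((k₃−k₁)/2) sin²((k₂−k₃)/2)`, `p = (k₁,(k₃,k₂))`), the pushforward of `W dk` (cell
`(−π,π]³`) under the pair resonance function has a continuous non-negative density on a window `(−δ, δ)`,
`δ > 0` — `forceWindow_thresholdContinuous` in the registered `∀`-form. [folklore] -/
theorem forceWindow_thresholdContinuity : ∀ ω₂ : ℝ, 0 < ω₂ → ∀ (Cw : ℝ) (W : ℝ × ℝ × ℝ → ℝ), 0 ≤ Cw → Continuous W → (∀ p : ℝ × ℝ × ℝ, 0 ≤ W p) → (∀ p : ℝ × ℝ × ℝ, W (p.1 + 2 * Real.pi, p.2) = W p) → (∀ p : ℝ × ℝ × ℝ, W (p.1, p.2.1 + 2 * Real.pi, p.2.2) = W p) → (∀ p : ℝ × ℝ × ℝ, W (p.1, p.2.1, p.2.2 + 2 * Real.pi) = W p) → (∀ p : ℝ × ℝ × ℝ, W p ≤ Cw * Real.sin ((p.2.1 - p.1) / 2) ^ 2 * Real.sin ((p.2.2 - p.2.1) / 2) ^ 2) → ∃ δ : ℝ, 0 < δ ∧ ∃ ρ : ℝ → ℝ, ContinuousOn ρ (Set.Ioo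 (-δ) δ) ∧ (∀ x ∈ Set.Ioo (-δ) δ, 0 ≤ ρ x) ∧ (MeasureTheory.Measure.map (fun p : ℝ × ℝ × ℝ => Literature.MathematicalPhysics.KineticTheory.PhononBoltzmann.resonanceFn ω₂ p.1 p.2.2 p.2.1) (((MeasureTheory.volume.restrict (Set.Ioc (-Real.pi) Real.pi)).prod ((MeasureTheory.volume.restrict (Set.Ioc (-Real.pi) Real.pi)).prod (MeasureTheory.volume.restrict (Set.Ioc (-Real.pi) Real.pi)))).withDensity (fun p : ℝ × ℝ × ℝ => ENNReal.ofReal (W p)))).restrict (Set.Ioo (-δ) δ) = (MeasureTheory.volume.restrict (Set.Ioo (-δ) δ)).withDensity (fun x => ENNReal.ofReal (ρ x)) :=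
  fun _ hω Cw W hCw hWc hW0 hW₁ hW₂ hW₃ hW =>
    forceWindow_thresholdContinuous hω (Cw := Cw) (W := W) hCw hWc hW0 hW₁ hW₂ hW₃ hW

end Summit.AtomisticToContinuum.FouriersLaw.Theorems.DrudeDissolution.GramPencilHarmonicChaos

end
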